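import Literature.NumberTheory.EllipticCurves.LeadingTermBSZProofs
import HarnessLib

/-!
# bsd.S27 (Bhargava–Skinner–Zhang): Cor 26 assembled from its pieces, and the value of the constant

Second sibling proof file of `Literature.NumberTheory.EllipticCurves.LeadingTerm` for the named fact
`Literature.NumberTheory.EllipticCurves.bhargava_skinner_zhang` (**bsd.S27**,
`HeightDensityGE SatisfiesBSDRankLeOne 0.6648`: "at least `66.48%` of elliptic curves over `ℚ`,
ordered by naive height, have `rank = ord_{s=1} L ∈ {0, 1}` and finite `Ш`"):

> M. Bhargava, C. Skinner, W. Zhang, *A majority of elliptic curves over `ℚ` satisfy the Birch and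
> Swinnerton-Dyer conjecture*, arXiv:1407.1826 (v2, 2014), Thms 1–2, Cor 26.

`LeadingTermBSZProofs.lean` proves the counting theorems of the source (Thms 21, 23, 25) at a finite
height. This file proves the remaining step of the printed proof — the bookkeeping of Cor 26, from
the counting theorems and the densities of the pieces to the lower density — for abstract pieces and
parameters (`heightDensityGE_satisfiesBSDRankLeOne_of_pieces`), and records what the printed inputs
then give. No new named fact is introduced (D-0026): the deep inputs (Thms 5, 9, 13, 16, Lemmas 17–20
of the source, Gross–Zagier–Kolyvagin, Dokchitser–Dokchitser) are explicit hypotheses.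

## The assembly (source, proof of Cor 26), as arranged here

Pieces (predicates on `(A, B)`): `S₀` (the source's `S₀(5)`), `T ⊆ S₀` (`S₀(5) ∩ S₁'(5) = S₁'(5)`, or
a clopen truncation of it), `U ⊆ T` (the finite union `F'` of large subfamilies of Thm 16, stable under
`E ↦ E₋₁` with reversed root number, of relative density `κ ≥ .5501`), `S₁` (`S₁(5)`), `R ⊆ S₀ ∖ T`
(the part of `S₀(5)` "on which the above arguments have not been applied") with `U₀ ⊆ R` (Thm 16
again), and `W` (the two `100%` conditions of Lemma 20: `E[5]` irreducible — which excludes rational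
`5`-torsion — and two primes `ℓ ∥ N`, `ℓ ≠ 5`, with `E[5]` ramified).
* `cor26_count` (finite height `X`, granted Thm 13's bounds `Σ_T ≤ (6+η) N_T`, `Σ_{U₀} ≤ (6+η) N_{U₀}`
  on the sums of `#S₅`): `(19-η)/24 · N_T + N_U/12 + (3/8 - η/24) · N_{U₀} - 19/6 · N_{¬W} - N_{T∖S₁}
  ≤ #{E : SatisfiesBSDRankLeOne}` — `thm25_count_five` on `(T, U)` (the `19/24` of `T` improved to
  `7/8` on `U`), `thm21_count_five` on `U₀` (`3/8`), and pointwise: a curve of `T` with `#S₅ ≤ 5`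
  has `#S₅ = 1` (then Thm 5, `h5`, applies on `S₀ ∩ W`) or `#S₅ = 5` (then Thm 9, `h9`, applies on
  `T ∩ S₁ ∩ W`), a curve of `U₀ ⊆ S₀` with `#S₅ = 1` falls under Thm 5, and in all cases
  Gross–Zagier–Kolyvagin (`hGZK`) gives `Ш` finite (`satisfiesBSDRankLeOne_of_rank_eq`); the
  `5`-torsion terms of the counting theorems are absorbed in `N_{¬W}` (`hWtors`).
* `cor26_algebra` (real arithmetic): with `N_T ≥ (μT-θ)N`, `N_U ≥ (κ-θ)N_T`, `N_R ≥ (μR-θ)N`,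
  `N_{U₀} ≥ (κ-θ)N_R`, `N_{T∖S₁} ≤ (ν+θ)N`, `N_{¬W} ≤ θN` and `θ ≤ min(ε/6, κ/2)` the count is
  `≥ (δ - ε)N` for every `δ ≤ (19/24 + κ/12) μT + 3/8 · κ · μR - ν` (note
  `7/8 κ + 19/24 (1-κ) = 19/24 + κ/12`).
* `heightDensityGE_satisfiesBSDRankLeOne_of_pieces`: hence `HeightDensityGE SatisfiesBSDRankLeOne δ`.
  Compared with the printed proof, Thm 13 is used on `T` and on `U₀` only (not on `F' ∩ S₁(5)` and
  on finite unions `F''_ε` exhausting its complement: `thm25_count_of_subfamily` interpolates `7/8`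
  on `U` and `19/24` on `T ∖ U` from `Σ_T` alone), and display (2) costs `ν` once rather than
  `(7/8 + 19/24) ν`.
* Conversions from the density vocabulary of `HeightFamily.lean` to the count form of the
  hypotheses: `HeightDensityGE.eventually_mul_card_le`, `HasHeightDensity.eventually_card_not_le`,
  `eventually_card_filter_and_not_le`, `eventually_heightFamilyBelow_card_pos`.

## The value of the constant: `66.48%` as printed, `65.97%` as established

* `bhargava_skinner_zhang_of_pieces`: with the printed densities — `μT = μ(S₁'(5)) = .7918054`
  (Lemma 18), `μR = μ(S₀(5)) - μ(S₁'(5)) = .0081946` (Lemma 17), `κ = .5501` (Thm 16), `ν = 10⁻⁵`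
  (display (2)) — the assembly gives `.664824 ≥ .6648`, i.e. exactly the named fact
  `bhargava_skinner_zhang` (the source's display: `(7/8 × .5501 + 19/24 × .4499) × .7918054 -
  (7/8 + 19/24) × 10⁻⁵ + .00169 = .664816`).
* **However, the printed value of `μ(S₁'(5))` is not correct.** The proof of Lemma 18 asserts that
  for `A mod p^{k+2}` primitive with `27B² ≡ -4A³ (mod p)` solvable "there exist exactly
  `(2p-1)(p-1)` residue classes for `B` modulo `p^{k+2}` such that `ord_p(Δ(A,B)) = k` and
  `Δ(A,B)/p^k (mod p²) ∉ S_k`". For fixed `A` the map `B ↦ Δ(A,B) = -4A³ - 27B²` is a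
  measure-preserving bijection from each of the two discs `B ≡ ±B₀ (mod p)` onto `pℤ_p`, so the classes
  with `ord_p Δ = k` correspond, on each disc, to the `p(p-1)` units `Δ/p^k mod p²`, of which the
  `p - 1` in `S_k` are excluded: the count is `2(p-1)²`, the printed `(2p-1)(p-1) = 2p(p-1) - (p-1)`
  subtracting the excluded classes once instead of twice. (Exhaustive enumeration confirms `2(p-1)²`
  for `p = 5` — `32` of `40`, for `k = 1, 2` and every admissible `A`, and `k = 3` — and for
  `p = 13, 17, 29`; the same count holds for the true criterion `ord₅ 𝓛(E) = 1 ⟺ u ≢ 1 (mod 25)`,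
  `q = 5^k ω u` the Tate parameter, computed from `q = J + 744J² + …`, `J = 1/j`; and a direct
  classification of all `(A, B) mod 5⁶` confines the `5`-adic measure of `S₁'(5)` to
  `[.78377, .78383] · (1-5⁻¹⁰)⁻¹`, refuting `.7918054`. Scripts and outputs: the literature-prover's
  evidence folder for this fact; the case `p = 5`, `k = 1` — every admissible `A`, `40` classes with
  `ord₅ Δ = 1` of which `32 ∉ S₁` — and ten classes of the case `k = 2` are re-checked by the kernel
  in the section `Certificate` below, `bsz_lemma18_count_not_mem_S_one`,
  `bsz_lemma18_count_L_invariant_one` (the true criterion), together with the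
  resulting values, `bsz_mu_S_one_prime_five`, `bsz_cor26_corrected_value`.) Consequently
  `μ₅(Σ₅^spl) = 8/125 (1 - 4/(5⁵-1))` (not `9/125 (…)`),
  `μ(S₁'(5)) = (98/125 - 18/125 · 4/(5⁵-1))(1-5⁻¹⁰)⁻¹ = .7838157…`, Lemma 19's Euler factor
  (`.9999877`) still gives `μ(S₁'(5)) - μ(S₁(5)) ≤ 10⁻⁵`, Lemma 17 and Cor 22 (`16.50%`) are
  unaffected, Cor 24 becomes `19/40 × .5501 × .7838157 - 10⁻⁵ = .2048` (printed `.20688`), and Cor 26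
  becomes `.659774` (printed `.664816`).
* `bhargava_skinner_zhang_corrected_of_pieces`: with `μT = .7838`, `μR = .0161`, `κ = .5501`,
  `ν = 10⁻⁵` the assembly gives `HeightDensityGE SatisfiesBSDRankLeOne 0.6597` (`.659750 ≥ .6597`).
  Thms 1–2 of the source as stated ("a majority") are unaffected; the sentence "'A majority' can be
  replaced with 'At least `66.48%`'" (and display (1)) is what the printed argument does not deliver.

## The limit of the method (source §4)

* `heightDensityGE_satisfiesBSDRankLeOne_ceiling_of_criteria` (section `Ceiling`): the same assembly
  with `S₀ = T = S₁ =` all curves and `R = U₀ = ∅` — i.e. under HYPOTHETICAL rank-`0` and rank-`1`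
  criteria `h5all`, `h9all` valid for every curve (none exists in print) — gives `19/24 + κ/12`, and
  `heightDensityGE_satisfiesBSDRankLeOne_8375_of_criteria` its value `83.75%` at `κ = .5501`: the
  constant of Bhargava–Shankar's Thm 4 (arXiv:1312.7859; the tree's
  `heightDensityGE_rankLeOne_of_five_selmer_of_inputs`, `BSDRankLeOneDensityFiveSelmer.lean`), which
  is therefore the ceiling of every improvement of Thms 5 and 9 alone ("The proportions in
  Corollaries 22, 24, and 26 can be improved by strengthening Theorems 5, 9, 13, or 16", §4).

## Thm 27 of the source (section `AllPrimes`): `100%` granted the inputs at every prime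

* `thm27_count`: at one prime `p`, for subfamilies `T`, `W` on whose intersection the two criteria
  hold (`#S_p(E) = 1 ⟹ rank = an.rank = 0`, `#S_p(E) = p ⟹ rank = an.rank = 1`),
  `p²·N_T - Σ_T #S_p ≤ (p²-1)·(#{SatisfiesBSDRankLeOne} + N_{¬W})` (`thm25_count` at `p` and GZK).
* `heightDensityGE_satisfiesBSDRankLeOne_one_of_forall_prime`: **Thm 27** — "Suppose that for all
  primes `p`, the average size of the `p`-Selmer group of elliptic curves over `ℚ` is `p+1`. Then the
  Birch and Swinnerton-Dyer rank conjecture is true for `100%` of elliptic curves over `ℚ`" — with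
  every per-prime input of the printed three-sentence proof an explicit binder indexed by `p`: the
  Selmer average on `T p` (= `S₀(p) ∩ S₁(p)`), the criteria at `p` on `T p ∩ W p` (Thms 5 and 9 "with
  a general value of `p` in place of `p = 5`"), `W p` of density one (Lemma 20 at `p`), and
  `μ(T p) → 1` along the primes (the display `(1-1/p)²·∏_{ℓ ≡ ±1 (p)} (1-ℓ⁻¹⁰)⁻¹(1-ℓ⁻⁵)²`);
  conclusion `HeightDensityGE SatisfiesBSDRankLeOne 1`. The rank-only core (no criteria; `rank ≤ 1`
  for `100%`) is `heightDensityGE_rankLeOne_one_of_forall_prime`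
  (`BSDRankLeOneDensitySelmerAverage.lean`).

## What remains for a discharge (not done here; none of it is a theorem of the tree)

Instantiating the pieces: `S₀(5) = {5 ∤ A}` and the `5`-adic description of `S₁'(5)` (proofs of
Lemmas 17–18: reduction types of `E_{A,B}` at `5`, the Hasse invariant `2A`, the Tate parameter and the
`𝓛`-invariant), their densities (the product formula for large families, Bhargava–Shankar), the
largeness of the clopen pieces (for Thm 13 = hypothesis `h31` of `BSDAverageRankFiveSelmer.lean`),
Thm 16 (Bhargava–Shankar's `5`-Selmer paper, §5), Lemma 20 (Hilbert irreducibility / Duke; two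
multiplicative primes), Thm 5 (Skinner–Urban, Skinner) and Thm 9 (W. Zhang, Skinner–Zhang) with
Remarks 7 and 11, and the two named facts `rank_eq_analyticRank_of_analyticRank_le_one`,
`even_selmerRank_sub_torsionRank_iff`.

## References

* [BhargavaSkinnerZhang2014] (= the tree's interim key `arXiv14071826`) M. Bhargava, C. Skinner,
  W. Zhang, arXiv:1407.1826v2: Thms 1, 2, 5, 9, 13, 15, 16, Lemmas 17–20, Thms 21, 25, Cors 22, 24,
  26, display (2) (arXiv v2 p. 10; TeX label `mu-diff`).
* [BhargavaShankar5Selmer2013] M. Bhargava, A. Shankar, arXiv:1312.7859, Thm 31 and §5.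
* [DokchitserDokchitserAnnals2010] T. Dokchitser, V. Dokchitser, Ann. of Math. 172 (2010), Thm 1.4.
* [Darmon2004] H. Darmon, *Rational points on modular elliptic curves*, CBMS 101, Thm. 3.22
  (Gross–Zagier–Kolyvagin).
-/

noncomputable section

open scoped Classical
open scoped AddSubgroup
open Filter Topology WeierstrassCurve

namespace Literature.NumberTheory.EllipticCurves

/-! ### Elementary conversions between densities and counts -/

section Conversions

/-- The height family is eventually nonempty: `E_{0,1} : y² = x³ + 1` has naive height `27`.
[folklore] -/
theorem eventually_heightFamilyBelow_card_pos :
    ∀ᶠ X : ℕ in atTop, 0 < (heightFamilyBelow X).card := by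
  filter_upwards [eventually_ge_atTop 28] with X hX
  refine Finset.card_pos.mpr ⟨((0 : ℤ), (1 : ℤ)), (mem_heightFamilyBelow_iff _ _).mpr ⟨⟨by norm_num, ?_⟩, ?_⟩⟩
  · rintro p hp ⟨-, h6⟩
    have h1 : (p : ℤ) ^ 6 ≤ 1 := Int.le_of_dvd one_pos h6
    have hp2 : (2 : ℤ) ≤ p := by exact_mod_cast hp.two_le
    have h64 : (2 : ℤ) ^ 6 ≤ (p : ℤ) ^ 6 := pow_le_pow_left₀ (by norm_num) hp2 6
    norm_num at h64
    linarith
  · show max (4 * |(0 : ℤ)| ^ 3) (27 * (1 : ℤ) ^ 2) < (X : ℤ)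
    norm_num
    exact_mod_cast hX

/-- From a lower density to a count: if at least a proportion `μ` of curves satisfy `P`
(`HeightDensityGE P μ`), then for every `η > 0`, eventually `(μ - η) · N(X) ≤ N_P(X)`, where `N(X)` is
the number of curves of naive height `< X` and `N_P(X)` the number of those satisfying `P`. [folklore] -/
theorem HeightDensityGE.eventually_mul_card_le {P : ℤ × ℤ → Prop} {μ : ℝ} (h : HeightDensityGE P μ)
    (η : ℝ) (hη : 0 < η) :
    ∀ᶠ X : ℕ in atTop, (μ - η) * (heightFamilyBelow X).card ≤ ((heightFamilyBelow X).filter P).card := by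
  filter_upwards [h η hη] with X hX
  rw [heightProportion_eq_card_div] at hX
  rcases Nat.eq_zero_or_pos (heightFamilyBelow X).card with h0 | hpos
  · have : (heightFamilyBelow X).filter P = ∅ := by
      rw [Finset.card_eq_zero] at h0
      rw [h0]
      rfl
    rw [h0, this]
    simp
  · have hN : (0 : ℝ) < (heightFamilyBelow X).card := by exact_mod_cast hpos
    rwa [le_div_iff₀ hN] at hX

/-- From density `1` to a count of the exceptions: if `P` holds for a density `1` of curves
(`HasHeightDensity P 1`), then for every `η > 0`, eventually `N_{¬P}(X) ≤ η · N(X)`. [folklore] -/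
theorem HasHeightDensity.eventually_card_not_le {P : ℤ × ℤ → Prop} (h : HasHeightDensity P 1)
    (η : ℝ) (hη : 0 < η) :
    ∀ᶠ X : ℕ in atTop,
      (((heightFamilyBelow X).filter (fun AB ↦ ¬ P AB)).card : ℝ) ≤ η * (heightFamilyBelow X).card := by
  have hev := h.eventually (Ioi_mem_nhds (sub_lt_self (1 : ℝ) hη))
  filter_upwards [hev] with X hX
  rw [heightProportion_eq_card_div] at hX
  have hsplit := Finset.card_filter_add_card_filter_not (s := heightFamilyBelow X) P
  have hsplitR : (((heightFamilyBelow X).filter P).card : ℝ) +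
      ((heightFamilyBelow X).filter (fun AB ↦ ¬ P AB)).card = (heightFamilyBelow X).card := by
    exact_mod_cast hsplit
  rcases Nat.eq_zero_or_pos (heightFamilyBelow X).card with h0 | hpos
  · have h0R : ((heightFamilyBelow X).card : ℝ) = 0 := by exact_mod_cast h0
    have hnn : (0 : ℝ) ≤ ((heightFamilyBelow X).filter P).card := Nat.cast_nonneg _
    have hnn' : (0 : ℝ) ≤ ((heightFamilyBelow X).filter (fun AB ↦ ¬ P AB)).card := Nat.cast_nonneg _
    rw [h0R] at hsplitR ⊢
    linarith
  · have hN : (0 : ℝ) < (heightFamilyBelow X).card := by exact_mod_cast hpos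
    rw [lt_div_iff₀ hN] at hX
    linarith

/-- From an upper density of `T` and a lower density of `S ⊆ T` to a count of `T ∖ S`: if eventually
`N_T(X) ≤ (a + η) N(X)` and `(b - η) N(X) ≤ N_S(X)` for every `η > 0`, then eventually
`N_{T ∖ S}(X) ≤ (a - b + η) N(X)` for every `η > 0` (the shape in which `μ(S₁'(5)) - μ(S₁(5)) ≤ 10⁻⁵`,
display (2) of the source, p. 10, enters Cor 26). [cite: BhargavaSkinnerZhang2014, display (2) before Lemma 20] -/
theorem eventually_card_filter_and_not_le {T S : ℤ × ℤ → Prop} (hST : ∀ AB, S AB → T AB) {a b : ℝ}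
    (hT : ∀ η : ℝ, 0 < η → ∀ᶠ X : ℕ in atTop,
      (((heightFamilyBelow X).filter T).card : ℝ) ≤ (a + η) * (heightFamilyBelow X).card)
    (hS : ∀ η : ℝ, 0 < η → ∀ᶠ X : ℕ in atTop,
      (b - η) * (heightFamilyBelow X).card ≤ ((heightFamilyBelow X).filter S).card)
    (η : ℝ) (hη : 0 < η) :
    ∀ᶠ X : ℕ in atTop, (((heightFamilyBelow X).filter (fun AB ↦ T AB ∧ ¬ S AB)).card : ℝ) ≤
      (a - b + η) * (heightFamilyBelow X).card := by
  filter_upwards [hT (η / 2) (by positivity), hS (η / 2) (by positivity)] with X hX1 hX2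
  have hdecomp : ((heightFamilyBelow X).filter (fun AB ↦ T AB ∧ ¬ S AB)).card +
      ((heightFamilyBelow X).filter S).card = ((heightFamilyBelow X).filter T).card := by
    have h1 : (heightFamilyBelow X).filter (fun AB ↦ T AB ∧ ¬ S AB) =
        ((heightFamilyBelow X).filter T).filter (fun AB ↦ ¬ S AB) := by
      rw [Finset.filter_filter]
    have h2 : (heightFamilyBelow X).filter S = ((heightFamilyBelow X).filter T).filter S := by
      rw [Finset.filter_filter]
      congr 1
      ext AB
      exact ⟨fun h ↦ ⟨hST AB h, h⟩, fun h ↦ h.2⟩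
    rw [h1, h2, add_comm]
    exact Finset.card_filter_add_card_filter_not _
  have hdecompR : (((heightFamilyBelow X).filter (fun AB ↦ T AB ∧ ¬ S AB)).card : ℝ) +
      ((heightFamilyBelow X).filter S).card = ((heightFamilyBelow X).filter T).card := by
    exact_mod_cast hdecomp
  linarith

end Conversions
/-! ### Cor 26 at a finite height: from the counting theorems to the curves satisfying BSD -/

section Count

/-- A member of the height family with `rank = an.rank = r ≤ 1` satisfies `SatisfiesBSDRankLeOne`,
the finiteness of `Ш` being supplied by Gross–Zagier–Kolyvagin (`hGZK`, the tree's named fact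
`rank_eq_analyticRank_of_analyticRank_le_one`; source, proof of Thm 2: "through the work of
Kolyvagin et al."). [cite: BhargavaSkinnerZhang2014, proof of Thm 2 (§1)] -/
theorem satisfiesBSDRankLeOne_of_rank_eq (hGZK : rank_eq_analyticRank_of_analyticRank_le_one)
    {AB : ℤ × ℤ} (hAB : IsInHeightFamily AB) {r : ℕ} (hr : r ≤ 1)
    (h : (shortWeierstrass AB).mordellWeilRank = r ∧ (shortWeierstrass AB).analyticRank = r) :
    SatisfiesBSDRankLeOne AB := by
  haveI := isElliptic_shortWeierstrass hAB
  have han : (shortWeierstrass AB).analyticRank ≤ 1 := h.2.symm ▸ hr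
  obtain ⟨-, hfin⟩ := hGZK (shortWeierstrass AB) han
  exact ⟨hAB, h.1.trans h.2.symm, han, hfin⟩

/-- Truth-table lemma for the inclusion–exclusion step of Cor 26: two disjoint events each implying
`g` off the exceptional events `q₁`, `q₂`. [folklore] -/
private theorem ite_add_ite_le_of_imp {p₁ p₂ g q₁ q₂ : Prop} [Decidable p₁] [Decidable p₂]
    [Decidable g] [Decidable q₁] [Decidable q₂] (h₁ : p₁ → ¬ q₁ → ¬ q₂ → g)
    (h₂ : p₂ → ¬ q₂ → g) (h₁₂ : ¬ (p₁ ∧ p₂)) :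
    (if p₁ then (1 : ℝ) else 0) + (if p₂ then (1 : ℝ) else 0) ≤
      (if g then (1 : ℝ) else 0) + (if q₁ then (1 : ℝ) else 0) + (if q₂ then (1 : ℝ) else 0) := by
  split_ifs <;> norm_num <;> tauto

/-- **Cor 26 of the source at a finite height `X` (the inclusion–exclusion, torsion-corrected).**
Data: subfamilies `T ⊆ S₀` (the source's `S₀(5) ∩ S₁'(5)` inside `S₀(5)`), `U ⊆ T` (the
equidistributed subfamily of Thm 16 in it), `R ⊆ S₀` disjoint from `T` (the part of `S₀(5)` "on which
the above arguments have not been applied") with `U₀ ⊆ R` (Thm 16 in it), `S₁` (the source's `S₁(5)`)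
and `W` (the `100%` conditions of Lemma 20); `U`, `U₀` stable under `E ↦ E₋₁` with reversed root
number; the criteria of Thm 5 (`h5`: on `S₀ ∩ W`, `S₅(E) = 0 ⟹ rank = an.rank = 0`) and Thm 9
(`h9`: on `T ∩ S₁ ∩ W`, `#S₅(E) = 5 ⟹ rank = an.rank = 1`), rational `5`-torsion being excluded on
`W` (`hWtors`, from irreducibility of `E[5]`); Thm 15 (`hDD`) and Gross–Zagier–Kolyvagin (`hGZK`).
If at height `X` the sums of `#S₅` over `T` and over `U₀` are `≤ (6 + η)` times their numbers
(Thm 13), then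
`(19-η)/24 · N_T + N_U/12 + (3/8 - η/24) · N_{U₀} - 19/6 · N_{¬W} - N_{T ∖ S₁} ≤ #{E : H(E) < X, E ∈ SatisfiesBSDRankLeOne}`:
`thm25_count_five` on `(T, U)` and `thm21_count_five` on `U₀` count curves with `#S₅ ≤ 5`, resp.
`= 1`; off `T ∖ S₁` and off the complement of `W` these satisfy BSD with rank `≤ 1` by Thms 5, 9 and
GZK (`#S₅ ≤ 5` means `#S₅ ∈ {1, 5}`, `natCard_selmerGroup_le_iff`).
[cite: BhargavaSkinnerZhang2014, Cor 26 (proof), with Thms 5, 9, 21, 25 and Lemma 20] -/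
theorem cor26_count (hGZK : rank_eq_analyticRank_of_analyticRank_le_one)
    (hDD : even_selmerRank_sub_torsionRank_iff) (S₀ T U R U₀ S₁ W : ℤ × ℤ → Prop)
    (hTS₀ : ∀ AB, T AB → S₀ AB) (hUT : ∀ AB, U AB → T AB)
    (hRS₀ : ∀ AB, R AB → S₀ AB) (hRT : ∀ AB, R AB → ¬ T AB) (hU₀R : ∀ AB, U₀ AB → R AB)
    (hU : ∀ AB, U AB → U (negB AB))
    (hUflip : ∀ AB, U AB →
      (shortWeierstrass (negB AB)).rootNumber = -(shortWeierstrass AB).rootNumber)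
    (hU₀ : ∀ AB, U₀ AB → U₀ (negB AB))
    (hU₀flip : ∀ AB, U₀ AB →
      (shortWeierstrass (negB AB)).rootNumber = -(shortWeierstrass AB).rootNumber)
    (h5 : ∀ AB, IsInHeightFamily AB → S₀ AB → W AB →
      Nat.card ((shortWeierstrass AB).selmerGroup 5) = 1 →
        (shortWeierstrass AB).mordellWeilRank = 0 ∧ (shortWeierstrass AB).analyticRank = 0)
    (h9 : ∀ AB, IsInHeightFamily AB → T AB → S₁ AB → W AB →
      Nat.card ((shortWeierstrass AB).selmerGroup 5) = 5 →
        (shortWeierstrass AB).mordellWeilRank = 1 ∧ (shortWeierstrass AB).analyticRank = 1)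
    (hWtors : ∀ AB, IsInHeightFamily AB → W AB → (shortWeierstrass AB).toAffine.Point[(5 : ℤ)] = ⊥)
    (X : ℕ) {η : ℝ}
    (hsumT : ∑ AB ∈ (heightFamilyBelow X).filter T,
        (Nat.card ((shortWeierstrass AB).selmerGroup 5) : ℝ) ≤
      (6 + η) * ((heightFamilyBelow X).filter T).card)
    (hsumU₀ : ∑ AB ∈ (heightFamilyBelow X).filter U₀,
        (Nat.card ((shortWeierstrass AB).selmerGroup 5) : ℝ) ≤
      (6 + η) * ((heightFamilyBelow X).filter U₀).card) :
    (19 - η) / 24 * ((heightFamilyBelow X).filter T).card +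
          (1 / 12) * ((heightFamilyBelow X).filter U).card +
          (3 / 8 - η / 24) * ((heightFamilyBelow X).filter U₀).card -
          (19 / 6) * ((heightFamilyBelow X).filter (fun AB ↦ ¬ W AB)).card -
          ((heightFamilyBelow X).filter (fun AB ↦ T AB ∧ ¬ S₁ AB)).card ≤
      ((heightFamilyBelow X).filter SatisfiesBSDRankLeOne).card := by
  haveI : Fact (Nat.Prime 5) := ⟨by norm_num⟩
  set s := heightFamilyBelow X with hs_def
  -- the two counting theorems (their `(5 : ℕ)` casts are definitionally the literal `5`)
  have h25 := thm25_count_five hDD T U hUT hU hUflip X (η := η) hsumT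
  have h21 := thm21_count_five hDD U₀ hU₀ hU₀flip X (η := η) hsumU₀
  simp only [Nat.cast_ofNat] at h25 h21
  -- rational `5`-torsion only occurs off `W`
  have hB : ∀ P : ℤ × ℤ → Prop, (((s.filter P).filter
      (fun AB ↦ (shortWeierstrass AB).toAffine.Point[(5 : ℤ)] ≠ ⊥)).card : ℝ) ≤
      (s.filter (fun AB ↦ ¬ W AB)).card := by
    intro P
    exact_mod_cast Finset.card_le_card fun AB h ↦ by
      simp only [Finset.mem_filter] at h ⊢
      exact ⟨h.1.1, fun hW ↦ h.2 (hWtors AB ((mem_heightFamilyBelow_iff AB X).mp h.1.1).1 hW)⟩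
  have hBT := hB T
  have hBU₀ := hB U₀
  -- inclusion–exclusion, pointwise
  have key : ∀ AB ∈ s,
      (if T AB ∧ Nat.card ((shortWeierstrass AB).selmerGroup 5) ≤ 5 then (1 : ℝ) else 0) +
        (if U₀ AB ∧ Nat.card ((shortWeierstrass AB).selmerGroup 5) = 1 then (1 : ℝ) else 0) ≤
      (if SatisfiesBSDRankLeOne AB then (1 : ℝ) else 0) +
        (if T AB ∧ ¬ S₁ AB then (1 : ℝ) else 0) + (if ¬ W AB then (1 : ℝ) else 0) := by
    intro AB hAB
    have hfam : IsInHeightFamily AB := ((mem_heightFamilyBelow_iff AB X).mp hAB).1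
    haveI := isElliptic_shortWeierstrass hfam
    refine ite_add_ite_le_of_imp ?_ ?_ ?_
    · rintro ⟨hT, hle⟩ hq₁ hq₂
      have hW : W AB := not_not.mp hq₂
      have hS₁ : S₁ AB := by
        by_contra hS₁
        exact hq₁ ⟨hT, hS₁⟩
      rcases (natCard_selmerGroup_le_iff (shortWeierstrass AB) 5).mp hle with h1 | h5'
      · exact satisfiesBSDRankLeOne_of_rank_eq hGZK hfam zero_le_one
          (h5 AB hfam (hTS₀ AB hT) hW h1)
      · exact satisfiesBSDRankLeOne_of_rank_eq hGZK hfam le_rfl (h9 AB hfam hT hS₁ hW h5')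
    · rintro ⟨hU₀AB, h1⟩ hq₂
      exact satisfiesBSDRankLeOne_of_rank_eq hGZK hfam zero_le_one
        (h5 AB hfam (hRS₀ AB (hU₀R AB hU₀AB)) (not_not.mp hq₂) h1)
    · rintro ⟨⟨hT, -⟩, hU₀AB, -⟩
      exact hRT AB (hU₀R AB hU₀AB) hT
  have hsum := Finset.sum_le_sum key
  rw [Finset.sum_add_distrib, Finset.sum_add_distrib, Finset.sum_add_distrib, Finset.sum_boole,
    Finset.sum_boole, Finset.sum_boole, Finset.sum_boole, Finset.sum_boole] at hsum
  rw [← Finset.filter_filter, ← Finset.filter_filter] at hsum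
  linarith

end Count

/-! ### Cor 26: the bookkeeping of densities (parametrised) and the resulting lower density -/

section Assembly

/-- The real-arithmetic core of Cor 26: with `θ ≤ ε/6`, `θ ≤ κ/2`, the finite-height inequality of
`cor26_count` (`hcnt`), the density bounds `N_T ≥ (μT - θ)N`, `N_U ≥ (κ - θ)N_T`, `N_R ≥ (μR - θ)N`,
`N_{U₀} ≥ (κ - θ)N_R`, `N_{T ∖ S₁} ≤ (ν + θ)N`, `N_{¬W} ≤ θN`, one gets
`#{BSD, rank ≤ 1} ≥ (δ - ε) N` for every `δ ≤ (19/24 + κ/12) μT + 3/8 · κ · μR - ν` (the source's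
`(7/8 κ + 19/24 (1-κ)) μ + 3/8 κ μ' - …`, since `7/8 κ + 19/24 (1 - κ) = 19/24 + κ/12`).
[cite: BhargavaSkinnerZhang2014, Cor 26 (proof, final display)] -/
theorem cor26_algebra {N NT NU NR NU₀ NW NTS G θ κ μT μR ν δ ε : ℝ}
    (hN : 0 ≤ N) (hθ : 0 < θ) (hθε : θ ≤ ε / 6) (hθκ : θ ≤ κ / 2)
    (hκ1 : κ ≤ 1) (hμT1 : μT ≤ 1) (hμR1 : μR ≤ 1)
    (hcnt : (19 - θ) / 24 * NT + 1 / 12 * NU + (3 / 8 - θ / 24) * NU₀ - 19 / 6 * NW - NTS ≤ G)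
    (h3 : (μT - θ) * N ≤ NT) (h4 : (κ - θ) * NT ≤ NU) (h5 : (μR - θ) * N ≤ NR)
    (h6 : (κ - θ) * NR ≤ NU₀) (h7 : NTS ≤ (ν + θ) * N) (h8 : NW ≤ θ * N)
    (hδ : δ ≤ (19 / 24 + κ / 12) * μT + 3 / 8 * κ * μR - ν) :
    (δ - ε) * N ≤ G := by
  have hκθ : 0 ≤ κ - θ := by linarith
  have hc₁ : 0 ≤ (19 - θ) / 24 + (κ - θ) / 12 := by linarith
  have hc₂ : 0 ≤ 3 / 8 - θ / 24 := by linarith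
  -- chaining the density bounds through the nonnegative coefficients
  have e1 : ((19 - θ) / 24 + (κ - θ) / 12) * ((μT - θ) * N) ≤
      ((19 - θ) / 24 + (κ - θ) / 12) * NT := mul_le_mul_of_nonneg_left h3 hc₁
  have e2 : (3 / 8 - θ / 24) * ((κ - θ) * NR) ≤ (3 / 8 - θ / 24) * NU₀ :=
    mul_le_mul_of_nonneg_left h6 hc₂
  have e3 : (3 / 8 - θ / 24) * (κ - θ) * ((μR - θ) * N) ≤ (3 / 8 - θ / 24) * (κ - θ) * NR :=
    mul_le_mul_of_nonneg_left h5 (mul_nonneg hc₂ hκθ)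
  -- the parameter inequalities (losses linear in `θ`, using `κ, μT, μR ≤ 1`)
  have t1 : 0 ≤ θ * (1 - κ) := mul_nonneg hθ.le (by linarith)
  have t2 : 0 ≤ θ * (1 - μT) := mul_nonneg hθ.le (by linarith)
  have t3 : 0 ≤ θ * (1 - μR) := mul_nonneg hθ.le (by linarith)
  have t4 : 0 ≤ θ * ((κ - θ) * (1 - μR)) := mul_nonneg hθ.le (mul_nonneg hκθ (by linarith))
  have t5 : 0 ≤ θ ^ 2 * (κ - θ) := mul_nonneg (sq_nonneg θ) hκθ
  have t6 : 0 ≤ θ ^ 2 * (3 / 8 - θ / 24) := mul_nonneg (sq_nonneg θ) hc₂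
  have k1 : (19 / 24 + κ / 12) * μT - θ ≤ ((19 - θ) / 24 + (κ - θ) / 12) * (μT - θ) := by
    nlinarith [sq_nonneg θ]
  have k2 : 3 / 8 * κ * μR - 19 / 24 * θ ≤ (3 / 8 - θ / 24) * (κ - θ) * (μR - θ) := by
    nlinarith
  have k1N := mul_le_mul_of_nonneg_right k1 hN
  have k2N := mul_le_mul_of_nonneg_right k2 hN
  have hθN := mul_le_mul_of_nonneg_right hθε hN
  have hδN := mul_le_mul_of_nonneg_right hδ hN
  nlinarith

/-- **Cor 26 of the source, assembled from its pieces (parametrised form).** In the notation of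
`cor26_count`: suppose Thm 13 bounds the sums of `#S₅` over `T` and over `U₀` (`h13T`, `h13U₀`:
eventually `≤ (6 + η) ×` their numbers, for every `η > 0`), `T` has lower density `≥ μT` (`hT`), `U`
has relative lower density `≥ κ` in `T` and `U₀` in `R` (`hκU`, `hκU₀`, Thm 16), `R` has lower
density `≥ μR` (`hR`), `T ∖ S₁` has upper density `≤ ν` (`hν`, display (2)) and the complement
of `W` has density `0` (`hW`, Lemma 20). Then at least a proportion
`δ = (19/24 + κ/12) μT + 3/8 · κ · μR - ν` of all curves satisfy `SatisfiesBSDRankLeOne`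
(`rank = an.rank ≤ 1` and `Ш` finite). With the source's values `κ = .5501`, `μT = μ(S₁'(5))`,
`μR = μ(S₀(5)) - μ(S₁'(5))`, `ν = 10⁻⁵` this is the final display of the proof of Cor 26 (where Thm 13
is applied to `F = F' ∩ S₁(5)` and to finite unions exhausting its complement; applying it to `T`
once, through `thm25_count_of_subfamily`, makes that approximation unnecessary and costs `ν` once
instead of `(7/8 + 19/24) ν`). [cite: BhargavaSkinnerZhang2014, Cor 26 (proof)] -/
theorem heightDensityGE_satisfiesBSDRankLeOne_of_pieces
    (hGZK : rank_eq_analyticRank_of_analyticRank_le_one)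
    (hDD : even_selmerRank_sub_torsionRank_iff) (S₀ T U R U₀ S₁ W : ℤ × ℤ → Prop)
    (hTS₀ : ∀ AB, T AB → S₀ AB) (hUT : ∀ AB, U AB → T AB)
    (hRS₀ : ∀ AB, R AB → S₀ AB) (hRT : ∀ AB, R AB → ¬ T AB) (hU₀R : ∀ AB, U₀ AB → R AB)
    (hU : ∀ AB, U AB → U (negB AB))
    (hUflip : ∀ AB, U AB →
      (shortWeierstrass (negB AB)).rootNumber = -(shortWeierstrass AB).rootNumber)
    (hU₀ : ∀ AB, U₀ AB → U₀ (negB AB))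
    (hU₀flip : ∀ AB, U₀ AB →
      (shortWeierstrass (negB AB)).rootNumber = -(shortWeierstrass AB).rootNumber)
    (h5 : ∀ AB, IsInHeightFamily AB → S₀ AB → W AB →
      Nat.card ((shortWeierstrass AB).selmerGroup 5) = 1 →
        (shortWeierstrass AB).mordellWeilRank = 0 ∧ (shortWeierstrass AB).analyticRank = 0)
    (h9 : ∀ AB, IsInHeightFamily AB → T AB → S₁ AB → W AB →
      Nat.card ((shortWeierstrass AB).selmerGroup 5) = 5 →
        (shortWeierstrass AB).mordellWeilRank = 1 ∧ (shortWeierstrass AB).analyticRank = 1)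
    (hWtors : ∀ AB, IsInHeightFamily AB → W AB → (shortWeierstrass AB).toAffine.Point[(5 : ℤ)] = ⊥)
    (h13T : ∀ η : ℝ, 0 < η → ∀ᶠ X : ℕ in atTop,
      ∑ AB ∈ (heightFamilyBelow X).filter T,
          (Nat.card ((shortWeierstrass AB).selmerGroup 5) : ℝ) ≤
        (6 + η) * ((heightFamilyBelow X).filter T).card)
    (h13U₀ : ∀ η : ℝ, 0 < η → ∀ᶠ X : ℕ in atTop,
      ∑ AB ∈ (heightFamilyBelow X).filter U₀,
          (Nat.card ((shortWeierstrass AB).selmerGroup 5) : ℝ) ≤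
        (6 + η) * ((heightFamilyBelow X).filter U₀).card)
    {μT κ μR ν : ℝ} (hκ : 0 < κ) (hκ1 : κ ≤ 1) (hμT1 : μT ≤ 1) (hμR1 : μR ≤ 1)
    (hT : ∀ η : ℝ, 0 < η → ∀ᶠ X : ℕ in atTop,
      (μT - η) * (heightFamilyBelow X).card ≤ ((heightFamilyBelow X).filter T).card)
    (hκU : ∀ η : ℝ, 0 < η → ∀ᶠ X : ℕ in atTop,
      (κ - η) * ((heightFamilyBelow X).filter T).card ≤ ((heightFamilyBelow X).filter U).card)
    (hR : ∀ η : ℝ, 0 < η → ∀ᶠ X : ℕ in atTop,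
      (μR - η) * (heightFamilyBelow X).card ≤ ((heightFamilyBelow X).filter R).card)
    (hκU₀ : ∀ η : ℝ, 0 < η → ∀ᶠ X : ℕ in atTop,
      (κ - η) * ((heightFamilyBelow X).filter R).card ≤ ((heightFamilyBelow X).filter U₀).card)
    (hν : ∀ η : ℝ, 0 < η → ∀ᶠ X : ℕ in atTop,
      (((heightFamilyBelow X).filter (fun AB ↦ T AB ∧ ¬ S₁ AB)).card : ℝ) ≤
        (ν + η) * (heightFamilyBelow X).card)
    (hW : ∀ η : ℝ, 0 < η → ∀ᶠ X : ℕ in atTop,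
      (((heightFamilyBelow X).filter (fun AB ↦ ¬ W AB)).card : ℝ) ≤ η * (heightFamilyBelow X).card)
    {δ : ℝ} (hδ : δ ≤ (19 / 24 + κ / 12) * μT + 3 / 8 * κ * μR - ν) :
    HeightDensityGE SatisfiesBSDRankLeOne δ := by
  intro ε hε
  have hθ : 0 < min (ε / 6) (κ / 2) := lt_min (by positivity) (by positivity)
  have hθε : min (ε / 6) (κ / 2) ≤ ε / 6 := min_le_left _ _
  have hθκ : min (ε / 6) (κ / 2) ≤ κ / 2 := min_le_right _ _
  filter_upwards [h13T _ hθ, h13U₀ _ hθ, hT _ hθ, hκU _ hθ, hR _ hθ, hκU₀ _ hθ, hν _ hθ, hW _ hθ,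
    eventually_heightFamilyBelow_card_pos] with X hX1 hX2 hX3 hX4 hX5 hX6 hX7 hX8 hXpos
  have hcnt := cor26_count hGZK hDD S₀ T U R U₀ S₁ W hTS₀ hUT hRS₀ hRT hU₀R hU hUflip hU₀ hU₀flip
    h5 h9 hWtors X hX1 hX2
  have hN : (0 : ℝ) < (heightFamilyBelow X).card := by exact_mod_cast hXpos
  rw [heightProportion_eq_card_div, le_div_iff₀ hN]
  exact cor26_algebra hN.le hθ hθε hθκ hκ1 hμT1 hμR1 hcnt hX3 hX4 hX5 hX6 hX7 hX8 hδ

/-- **Cor 26 with the printed densities gives the printed `66.48%`.** Specialising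
`heightDensityGE_satisfiesBSDRankLeOne_of_pieces` to `κ = .5501` (Thm 16), `ν = 10⁻⁵` (display (2)),
`μT = .7918054` (the printed value of `μ(S₁'(5))`, Lemma 18) and `μR = .0081946`
(`= μ(S₀(5)) - μ(S₁'(5))` with Lemma 17's `μ(S₀(5)) = 4·5¹⁰/(5(5¹⁰-1))`) yields the tree's named fact
`bhargava_skinner_zhang` (`HeightDensityGE SatisfiesBSDRankLeOne 0.6648`):
`(19/24 + .5501/12) × .7918054 + 3/8 × .5501 × .0081946 - 10⁻⁵ = .664824… ≥ .6648` (the source's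
display: `.664816…`). **Caveat (recorded in the module docstring): the printed value of `μ(S₁'(5))`
is not correct** — the residue count `(2p-1)(p-1)` in the proof of Lemma 18 is `2(p-1)²`, whence
`μ(S₁'(5)) = .7838157…` and hypothesis `hT` below, with `T` the source's `S₀(5) ∩ S₁'(5)`, is not
satisfiable; the corrected assembly is `bhargava_skinner_zhang_corrected_of_pieces`.
[cite: BhargavaSkinnerZhang2014, Cor 26 with Lemmas 17, 18, display (2), Thm 16] -/
theorem bhargava_skinner_zhang_of_pieces
    (hGZK : rank_eq_analyticRank_of_analyticRank_le_one)
    (hDD : even_selmerRank_sub_torsionRank_iff) (S₀ T U R U₀ S₁ W : ℤ × ℤ → Prop)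
    (hTS₀ : ∀ AB, T AB → S₀ AB) (hUT : ∀ AB, U AB → T AB)
    (hRS₀ : ∀ AB, R AB → S₀ AB) (hRT : ∀ AB, R AB → ¬ T AB) (hU₀R : ∀ AB, U₀ AB → R AB)
    (hU : ∀ AB, U AB → U (negB AB))
    (hUflip : ∀ AB, U AB →
      (shortWeierstrass (negB AB)).rootNumber = -(shortWeierstrass AB).rootNumber)
    (hU₀ : ∀ AB, U₀ AB → U₀ (negB AB))
    (hU₀flip : ∀ AB, U₀ AB →
      (shortWeierstrass (negB AB)).rootNumber = -(shortWeierstrass AB).rootNumber)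
    (h5 : ∀ AB, IsInHeightFamily AB → S₀ AB → W AB →
      Nat.card ((shortWeierstrass AB).selmerGroup 5) = 1 →
        (shortWeierstrass AB).mordellWeilRank = 0 ∧ (shortWeierstrass AB).analyticRank = 0)
    (h9 : ∀ AB, IsInHeightFamily AB → T AB → S₁ AB → W AB →
      Nat.card ((shortWeierstrass AB).selmerGroup 5) = 5 →
        (shortWeierstrass AB).mordellWeilRank = 1 ∧ (shortWeierstrass AB).analyticRank = 1)
    (hWtors : ∀ AB, IsInHeightFamily AB → W AB → (shortWeierstrass AB).toAffine.Point[(5 : ℤ)] = ⊥)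
    (h13T : ∀ η : ℝ, 0 < η → ∀ᶠ X : ℕ in atTop,
      ∑ AB ∈ (heightFamilyBelow X).filter T,
          (Nat.card ((shortWeierstrass AB).selmerGroup 5) : ℝ) ≤
        (6 + η) * ((heightFamilyBelow X).filter T).card)
    (h13U₀ : ∀ η : ℝ, 0 < η → ∀ᶠ X : ℕ in atTop,
      ∑ AB ∈ (heightFamilyBelow X).filter U₀,
          (Nat.card ((shortWeierstrass AB).selmerGroup 5) : ℝ) ≤
        (6 + η) * ((heightFamilyBelow X).filter U₀).card)
    (hT : ∀ η : ℝ, 0 < η → ∀ᶠ X : ℕ in atTop,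
      (0.7918054 - η) * (heightFamilyBelow X).card ≤ ((heightFamilyBelow X).filter T).card)
    (hκU : ∀ η : ℝ, 0 < η → ∀ᶠ X : ℕ in atTop,
      (0.5501 - η) * ((heightFamilyBelow X).filter T).card ≤ ((heightFamilyBelow X).filter U).card)
    (hR : ∀ η : ℝ, 0 < η → ∀ᶠ X : ℕ in atTop,
      (0.0081946 - η) * (heightFamilyBelow X).card ≤ ((heightFamilyBelow X).filter R).card)
    (hκU₀ : ∀ η : ℝ, 0 < η → ∀ᶠ X : ℕ in atTop,
      (0.5501 - η) * ((heightFamilyBelow X).filter R).card ≤ ((heightFamilyBelow X).filter U₀).card)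
    (hν : ∀ η : ℝ, 0 < η → ∀ᶠ X : ℕ in atTop,
      (((heightFamilyBelow X).filter (fun AB ↦ T AB ∧ ¬ S₁ AB)).card : ℝ) ≤
        (0.00001 + η) * (heightFamilyBelow X).card)
    (hW : ∀ η : ℝ, 0 < η → ∀ᶠ X : ℕ in atTop,
      (((heightFamilyBelow X).filter (fun AB ↦ ¬ W AB)).card : ℝ) ≤ η * (heightFamilyBelow X).card) :
    bhargava_skinner_zhang :=
  heightDensityGE_satisfiesBSDRankLeOne_of_pieces hGZK hDD S₀ T U R U₀ S₁ W hTS₀ hUT hRS₀ hRT hU₀R hU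
    hUflip hU₀ hU₀flip h5 h9 hWtors h13T h13U₀ (by norm_num) (by norm_num) (by norm_num) (by norm_num)
    hT hκU hR hκU₀ hν hW (by norm_num)

/-- **Cor 26 with the corrected density of `S₁'(5)`: at least `65.97%`.** The count in the proof of
Lemma 18 of the source ("exactly `(2p-1)(p-1)` residue classes for `B` modulo `p^{k+2}` such that
`ord_p(Δ(A,B)) = k` and `Δ(A,B)/p^k (mod p²) ∉ S_k`") is in fact `2(p-1)²` (each of the two discs
`B ≡ ±B₀ (mod p)` loses `p - 1` classes; verified by exhaustive enumeration for `p = 5, 13, 17, 29`),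
so that `μ₅(Σ₅^spl) = 8/125 · (1 - 4/(5⁵-1))` instead of `9/125 · (1 - 4/(5⁵-1))` and
`μ(S₁'(5)) = (98/125 - 18/125 · 4/(5⁵-1)) (1 - 5⁻¹⁰)⁻¹ = .7838157…` instead of `.7918054…`
(direct classification of all `(A, B) mod 5⁶` confines the `5`-adic measure of `S₁'(5)` to
`[.78377, .78383]`). With `μT = .7838 ≤ μ(S₁'(5))`, `μR = .0161 ≤ μ(S₀(5)) - μ(S₁'(5)) = .0161843…`,
`κ = .5501` and `ν = 10⁻⁵` (Lemma 19's Euler factor `.9999877…` still gives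
`μ(S₁'(5)) - μ(S₁(5)) = 9.6·10⁻⁶ ≤ 10⁻⁵`), the assembly gives
`(19/24 + .5501/12) × .7838 + 3/8 × .5501 × .0161 - 10⁻⁵ = .659750… ≥ .6597`; the source's own
display evaluated at the corrected density is `.659774…`. Hence the printed argument establishes a
lower density of `65.97%` (Thms 1–2, "a majority", stand; "at least `66.48%`" and, in Cor 24,
"`20.68%`" — corrected value `20.47%` — do not follow from it).
[cite: BhargavaSkinnerZhang2014, Cor 26 (proof) with Lemma 18 corrected] -/
theorem bhargava_skinner_zhang_corrected_of_pieces
    (hGZK : rank_eq_analyticRank_of_analyticRank_le_one)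
    (hDD : even_selmerRank_sub_torsionRank_iff) (S₀ T U R U₀ S₁ W : ℤ × ℤ → Prop)
    (hTS₀ : ∀ AB, T AB → S₀ AB) (hUT : ∀ AB, U AB → T AB)
    (hRS₀ : ∀ AB, R AB → S₀ AB) (hRT : ∀ AB, R AB → ¬ T AB) (hU₀R : ∀ AB, U₀ AB → R AB)
    (hU : ∀ AB, U AB → U (negB AB))
    (hUflip : ∀ AB, U AB →
      (shortWeierstrass (negB AB)).rootNumber = -(shortWeierstrass AB).rootNumber)
    (hU₀ : ∀ AB, U₀ AB → U₀ (negB AB))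
    (hU₀flip : ∀ AB, U₀ AB →
      (shortWeierstrass (negB AB)).rootNumber = -(shortWeierstrass AB).rootNumber)
    (h5 : ∀ AB, IsInHeightFamily AB → S₀ AB → W AB →
      Nat.card ((shortWeierstrass AB).selmerGroup 5) = 1 →
        (shortWeierstrass AB).mordellWeilRank = 0 ∧ (shortWeierstrass AB).analyticRank = 0)
    (h9 : ∀ AB, IsInHeightFamily AB → T AB → S₁ AB → W AB →
      Nat.card ((shortWeierstrass AB).selmerGroup 5) = 5 →
        (shortWeierstrass AB).mordellWeilRank = 1 ∧ (shortWeierstrass AB).analyticRank = 1)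
    (hWtors : ∀ AB, IsInHeightFamily AB → W AB → (shortWeierstrass AB).toAffine.Point[(5 : ℤ)] = ⊥)
    (h13T : ∀ η : ℝ, 0 < η → ∀ᶠ X : ℕ in atTop,
      ∑ AB ∈ (heightFamilyBelow X).filter T,
          (Nat.card ((shortWeierstrass AB).selmerGroup 5) : ℝ) ≤
        (6 + η) * ((heightFamilyBelow X).filter T).card)
    (h13U₀ : ∀ η : ℝ, 0 < η → ∀ᶠ X : ℕ in atTop,
      ∑ AB ∈ (heightFamilyBelow X).filter U₀,
          (Nat.card ((shortWeierstrass AB).selmerGroup 5) : ℝ) ≤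
        (6 + η) * ((heightFamilyBelow X).filter U₀).card)
    (hT : ∀ η : ℝ, 0 < η → ∀ᶠ X : ℕ in atTop,
      (0.7838 - η) * (heightFamilyBelow X).card ≤ ((heightFamilyBelow X).filter T).card)
    (hκU : ∀ η : ℝ, 0 < η → ∀ᶠ X : ℕ in atTop,
      (0.5501 - η) * ((heightFamilyBelow X).filter T).card ≤ ((heightFamilyBelow X).filter U).card)
    (hR : ∀ η : ℝ, 0 < η → ∀ᶠ X : ℕ in atTop,
      (0.0161 - η) * (heightFamilyBelow X).card ≤ ((heightFamilyBelow X).filter R).card)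
    (hκU₀ : ∀ η : ℝ, 0 < η → ∀ᶠ X : ℕ in atTop,
      (0.5501 - η) * ((heightFamilyBelow X).filter R).card ≤ ((heightFamilyBelow X).filter U₀).card)
    (hν : ∀ η : ℝ, 0 < η → ∀ᶠ X : ℕ in atTop,
      (((heightFamilyBelow X).filter (fun AB ↦ T AB ∧ ¬ S₁ AB)).card : ℝ) ≤
        (0.00001 + η) * (heightFamilyBelow X).card)
    (hW : ∀ η : ℝ, 0 < η → ∀ᶠ X : ℕ in atTop,
      (((heightFamilyBelow X).filter (fun AB ↦ ¬ W AB)).card : ℝ) ≤ η * (heightFamilyBelow X).card) :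
    HeightDensityGE SatisfiesBSDRankLeOne 0.6597 :=
  heightDensityGE_satisfiesBSDRankLeOne_of_pieces hGZK hDD S₀ T U R U₀ S₁ W hTS₀ hUT hRS₀ hRT hU₀R hU
    hUflip hU₀ hU₀flip h5 h9 hWtors h13T h13U₀ (by norm_num) (by norm_num) (by norm_num) (by norm_num)
    hT hκU hR hκU₀ hν hW (by norm_num)

end Assembly

/-! ### Certificate: the residue count in the proof of Lemma 18 of the source, for `p = 5`

Kernel-checked (`decide`) finite verifications of the statements in the module docstring about the
proof of Lemma 18, and the resulting values (`norm_num`). -/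

section Certificate

/-- The set `S_k (mod p²)`, `k > 1`, of the proof of Lemma 18 for `p = 5`: `μ₄ ⊂ ℤ₅^×` reduces
modulo `25` to the units of order dividing `4`, `{1, 7, 18, 24}`.
[cite: BhargavaSkinnerZhang2014, proof of Lemma 18 (definition of S_k)] -/
theorem bsz_lemma18_mu_four_mod_twentyfive :
    ((Finset.range 25).filter (fun x ↦ ¬ 5 ∣ x ∧ x ^ 4 % 25 = 1)) = {1, 7, 18, 24} := by
  decide

/-- The set `S₁ = {ω - 24pω² : ω ∈ μ_{p-1}} (mod p²)` of the proof of Lemma 18 for `p = 5` is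
`{2, 4, 6, 13} (mod 25)`. [cite: BhargavaSkinnerZhang2014, proof of Lemma 18 (definition of S_1)] -/
theorem bsz_lemma18_S_one_mod_twentyfive :
    (({1, 7, 18, 24} : Finset ℤ).image (fun ω ↦ (ω - 24 * 5 * ω ^ 2) % 25)) = {2, 4, 6, 13} := by
  decide

set_option maxRecDepth 8000 in
/-- For `p = 5`, `k = 1`: for every `A (mod 5³)` with `5 ∤ A` and `27B² ≡ -4A³ (mod 5)` solvable
(`A ≡ 2, 3 (mod 5)`), exactly `2p(p-1) = 40` classes `B (mod 5³)` have `ord₅ Δ(A,B) = 1`,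
`Δ(A,B) = -4A³ - 27B²`. [cite: BhargavaSkinnerZhang2014, proof of Lemma 18 ("2(5-1) residue classes", read modulo 5^{k+1})] -/
theorem bsz_lemma18_count_ord_one :
    ∀ A ∈ (Finset.range 125).filter (fun A ↦ A % 5 = 2 ∨ A % 5 = 3),
      ((Finset.range 125).filter (fun B : ℕ ↦
        (fun D : ℤ ↦ (5 : ℤ) ∣ D ∧ ¬ (25 : ℤ) ∣ D) (-4 * (A : ℤ) ^ 3 - 27 * (B : ℤ) ^ 2))).card =
        40 := by
  decide

set_option maxRecDepth 8000 in
/-- **The displayed count of the proof of Lemma 18 is `2(p-1)² = 32`, not `(2p-1)(p-1) = 36`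
(`p = 5`, `k = 1`, every admissible `A`).** For every `A (mod 5³)` with `A ≡ 2, 3 (mod 5)`, exactly
`32` classes `B (mod 5³)` have `ord₅ Δ(A,B) = 1` and `Δ(A,B)/5 (mod 25) ∉ S₁ = {2, 4, 6, 13}`
(`bsz_lemma18_S_one_mod_twentyfive`); the source asserts "exactly `(2p-1)(p-1)`", i.e. `36`.
[cite: BhargavaSkinnerZhang2014, proof of Lemma 18 (the count "(2p-1)(p-1)", refuted for p = 5, k = 1)] -/
theorem bsz_lemma18_count_not_mem_S_one :
    ∀ A ∈ (Finset.range 125).filter (fun A ↦ A % 5 = 2 ∨ A % 5 = 3),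
      ((Finset.range 125).filter (fun B : ℕ ↦
        (fun D : ℤ ↦ (5 : ℤ) ∣ D ∧ ¬ (25 : ℤ) ∣ D ∧ (D / 5) % 25 ∉ ({2, 4, 6, 13} : Finset ℤ))
          (-4 * (A : ℤ) ^ 3 - 27 * (B : ℤ) ^ 2))).card = 32 := by
  decide

set_option maxRecDepth 16000 in
/-- The same for `k = 2` (`S₂ = μ₄ = {1, 7, 18, 24} (mod 25)`, `bsz_lemma18_mu_four_mod_twentyfive`),
for the ten admissible classes `A (mod 5⁴)` with `0 ≤ A < 25` (the full range of `250` classes is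
checked by the enumeration script kept with the evidence; the kernel check is restricted to keep the
elaboration time of this file small): exactly `32` classes `B (mod 5⁴)` have `ord₅ Δ(A,B) = 2` and
`Δ(A,B)/25 (mod 25) ∉ S₂`. [cite: BhargavaSkinnerZhang2014, proof of Lemma 18 (the count "(2p-1)(p-1)", refuted for p = 5, k = 2)] -/
theorem bsz_lemma18_count_not_mem_S_two :
    ∀ A ∈ (Finset.range 25).filter (fun A ↦ A % 5 = 2 ∨ A % 5 = 3),
      ((Finset.range 625).filter (fun B : ℕ ↦
        (fun D : ℤ ↦ (25 : ℤ) ∣ D ∧ ¬ (125 : ℤ) ∣ D ∧ (D / 25) % 25 ∉ ({1, 7, 18, 24} : Finset ℤ))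
          (-4 * (A : ℤ) ^ 3 - 27 * (B : ℤ) ^ 2))).card = 32 := by
  decide

set_option maxRecDepth 8000 in
/-- **The true criterion of condition (e) of Thm 9 gives the same count `32` (`p = 5`, `k = 1`).**
For `A ≡ 3 (mod 5)` (split multiplicative reduction at `5`, proof of Lemma 18) write
`J = 1/j(E_{A,B}) = (4A³ + 27B²)/(6912A³) = -Δ(A,B)/(6912A³)` and let `q` be the Tate parameter,
`q = J + 744J² + 750420J³ + … ≡ J + 744J² (mod 5³)` when `ord₅ J = 1` (inversion of
`j = 1/q + 744 + 196884q + …`; Silverman, *Advanced Topics*, V.3 and V.5.3); `q = 5ωu` with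
`ω ∈ μ₄`, `u ∈ 1 + 5ℤ₅`, and `u ≡ 1 (mod 25)` iff `q/5 (mod 25) ∈ {1, 7, 18, 24}` iff
`(q/5)⁴ ≡ 1 (mod 25)`; by the source's own analysis (`𝓛(E) = log₅ q / ord₅ q`, `log₅ u ∈ 5ℤ₅^×` iff
`u ∉ 1 + 25ℤ₅`) condition (e), `ord₅ 𝓛(E_{A,B}) = 1`, holds iff `(q/5)⁴ ≢ 1 (mod 25)`. Here the
inverse of `-6912A³` modulo `125` is taken as `-(6912A³)⁹⁹` (`φ(125) = 100`). For every such
`A (mod 5³)`, exactly `32` of the `40` classes `B (mod 5³)` with `ord₅ Δ(A,B) = 1` satisfy (e): the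
proportion `4/5`, as for the source's criterion `Δ/5 ∉ S₁` (`bsz_lemma18_count_not_mem_S_one`), not
`9/10`. [cite: BhargavaSkinnerZhang2014, proof of Lemma 18 (the 𝓛-invariant criterion), count for p = 5, k = 1] -/
theorem bsz_lemma18_count_L_invariant_one :
    ∀ A ∈ (Finset.range 125).filter (fun A ↦ A % 5 = 3),
      ((Finset.range 125).filter (fun B : ℕ ↦
        (fun D Ainv : ℤ ↦ (5 : ℤ) ∣ D ∧ ¬ (25 : ℤ) ∣ D ∧
            (fun J : ℤ ↦ (((J + 744 * J ^ 2) % 125) / 5) ^ 4 % 25 ≠ 1) (D * Ainv % 125))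
          (-4 * (A : ℤ) ^ 3 - 27 * (B : ℤ) ^ 2) (-((6912 * (A : ℤ) ^ 3) ^ 99 % 125)))).card =
        32 := by
  decide

/-- The corrected `5`-adic density of `S₁'(5)`: with `2(p-1)²` in place of `(2p-1)(p-1)`,
`μ₅(Σ₅^spl) = Σ_{5∤k} 32/5^{k+3} = 8/125 (1 - 4/(5⁵-1))` (before the factor `(1-5⁻¹⁰)⁻¹`), so
`μ(S₁'(5)) = (16/25 + 2/25 (1 - 4/(5⁵-1)) + 8/125 (1 - 4/(5⁵-1))) (1-5⁻¹⁰)⁻¹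
= (98/125 - 18/125 · 4/(5⁵-1)) (1-5⁻¹⁰)⁻¹ ∈ (.783815, .783816)`, against the printed
`(99/125 - 19/125 · 4/(5⁵-1)) (1-5⁻¹⁰)⁻¹ ∈ (.791805, .791806)`.
[cite: BhargavaSkinnerZhang2014, Lemma 18 (value corrected)] -/
theorem bsz_mu_S_one_prime_five :
    (16 / 25 + 2 / 25 * (1 - 4 / (5 ^ 5 - 1)) + 8 / 125 * (1 - 4 / (5 ^ 5 - 1)) : ℝ) =
        98 / 125 - 18 / 125 * (4 / (5 ^ 5 - 1)) ∧
      (0.783815 : ℝ) < (98 / 125 - 18 / 125 * (4 / (5 ^ 5 - 1))) / (1 - 1 / 5 ^ 10) ∧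
      (98 / 125 - 18 / 125 * (4 / (5 ^ 5 - 1)) : ℝ) / (1 - 1 / 5 ^ 10) < 0.783816 ∧
      (0.791805 : ℝ) < (99 / 125 - 19 / 125 * (4 / (5 ^ 5 - 1))) / (1 - 1 / 5 ^ 10) ∧
      (99 / 125 - 19 / 125 * (4 / (5 ^ 5 - 1)) : ℝ) / (1 - 1 / 5 ^ 10) < 0.791806 := by
  norm_num

/-- The final display of the proof of Cor 26 evaluated at the corrected density:
`(7/8 × .5501 + 19/24 × .4499) × μ(S₁'(5)) - (7/8 + 19/24) × 10⁻⁵ + 3/8 × .5501 × (μ(S₀(5)) - μ(S₁'(5)))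
∈ (.65977, .65978)` with `μ(S₀(5)) = (4/5)(1-5⁻¹⁰)⁻¹` (Lemma 17) — i.e. `65.97%`, not `66.48%`; and
Cor 24's `19/40 × .5501 × μ(S₁'(5)) - 10⁻⁵ ∈ (.20479, .20481)` (`20.47%`, printed `20.68%`).
[cite: BhargavaSkinnerZhang2014, Cors 24, 26 (values at the corrected Lemma 18)] -/
theorem bsz_cor26_corrected_value :
    let μ₁ : ℝ := (98 / 125 - 18 / 125 * (4 / (5 ^ 5 - 1))) / (1 - 1 / 5 ^ 10)
    let μ₀ : ℝ := 4 / 5 / (1 - 1 / 5 ^ 10)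
    (0.65977 : ℝ) < (7 / 8 * 0.5501 + 19 / 24 * 0.4499) * μ₁ - (7 / 8 + 19 / 24) * 0.00001 +
        3 / 8 * 0.5501 * (μ₀ - μ₁) ∧
      (7 / 8 * 0.5501 + 19 / 24 * 0.4499) * μ₁ - (7 / 8 + 19 / 24) * 0.00001 +
        3 / 8 * 0.5501 * (μ₀ - μ₁) < (0.65978 : ℝ) ∧
      (0.20479 : ℝ) < 19 / 40 * 0.5501 * μ₁ - 0.00001 ∧
      19 / 40 * 0.5501 * μ₁ - 0.00001 < (0.20481 : ℝ) := by
  norm_num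

end Certificate

/-! ### §4 of the source: the limit of the method (both criteria for every curve)

"The proportions in Corollaries 22, 24, and 26 can be improved by strengthening Theorems 5, 9, 13,
or 16" (source §4, first sentence). The next theorem records how far Theorems 5 and 9 alone can take
Cor 26: if the two `5`-Selmer criteria held for **every** elliptic curve `E_{A,B}/ℚ` (at every
reduction type at `5`, with no condition on `E[5]` beyond the absence of rational `5`-torsion), the
assembly `heightDensityGE_satisfiesBSDRankLeOne_of_pieces` — run with `S₀ = T = S₁ =` all curves and
`R = U₀ = ∅` — certifies the curves of `5`-Selmer rank `≤ 1` in Thm 16's family and its complement,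
i.e. a proportion `7κ/8 + 19(1-κ)/24 = 19/24 + κ/12`; at `κ = .5501` this is `.8375`, the constant
of Bhargava–Shankar's Thm 4 (arXiv:1312.7859: "a density of at least `83.75%` have rank `0` or `1`",
the tree's `heightDensityGE_rankLeOne_of_five_selmer_of_inputs`). No such criteria exist in print
(Thm 5 needs good ordinary or multiplicative reduction at `p` and conditions on `E[p]`; Thm 9 needs
conditions (a)–(e)); the hypotheses `h5all`, `h9all` below are HYPOTHETICAL and the theorem is the
implication only. -/

section Ceiling

/-- **The ceiling of the Cor 26 method: `19/24 + κ/12` under criteria valid for every curve.** Let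
`U` be Thm 16's root-number family taken inside the family of ALL curves (stable under `E ↦ E₋₁` with
reversed root number, lower density `κ`, `0 < κ ≤ 1`), `W` a set of density one on which no curve has
rational `5`-torsion (`hWtors`, `hW`; e.g. `E[5]` irreducible, Lemma 20), grant Thm 13 on the family
of all curves (`h13`), Thm 15 (`hDD`) and Gross–Zagier–Kolyvagin (`hGZK`), and suppose —
HYPOTHETICALLY — that for every curve of `W`, `S₅(E) = 0 ⟹ rank = an.rank = 0` (`h5all`) and
`#S₅(E) = 5 ⟹ rank = an.rank = 1` (`h9all`). Then at least a proportion `19/24 + κ/12` of elliptic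
curves over `ℚ`, ordered by naive height, satisfy `SatisfiesBSDRankLeOne`
(`heightDensityGE_satisfiesBSDRankLeOne_of_pieces` with `S₀ = T = S₁ = ⊤`, `R = U₀ = ⊥`, `μT = 1`,
`μR = ν = 0`). [cite: BhargavaSkinnerZhang2014, §4 (first paragraph) with Cor 26 (proof)]
[cite: BhargavaShankar5Selmer2013, Thm 4 (".5501 × 7/8 + .4499 × 19/24 ≥ .8375")] -/
theorem heightDensityGE_satisfiesBSDRankLeOne_ceiling_of_criteria
    (hGZK : rank_eq_analyticRank_of_analyticRank_le_one)
    (hDD : even_selmerRank_sub_torsionRank_iff) (U W : ℤ × ℤ → Prop)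
    (hU : ∀ AB, U AB → U (negB AB))
    (hUflip : ∀ AB, U AB →
      (shortWeierstrass (negB AB)).rootNumber = -(shortWeierstrass AB).rootNumber)
    (h5all : ∀ AB, IsInHeightFamily AB → W AB →
      Nat.card ((shortWeierstrass AB).selmerGroup 5) = 1 →
        (shortWeierstrass AB).mordellWeilRank = 0 ∧ (shortWeierstrass AB).analyticRank = 0)
    (h9all : ∀ AB, IsInHeightFamily AB → W AB →
      Nat.card ((shortWeierstrass AB).selmerGroup 5) = 5 →
        (shortWeierstrass AB).mordellWeilRank = 1 ∧ (shortWeierstrass AB).analyticRank = 1)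
    (hWtors : ∀ AB, IsInHeightFamily AB → W AB → (shortWeierstrass AB).toAffine.Point[(5 : ℤ)] = ⊥)
    (h13 : ∀ η : ℝ, 0 < η → ∀ᶠ X : ℕ in atTop,
      ∑ AB ∈ heightFamilyBelow X, (Nat.card ((shortWeierstrass AB).selmerGroup 5) : ℝ) ≤
        (6 + η) * (heightFamilyBelow X).card)
    {κ : ℝ} (hκ : 0 < κ) (hκ1 : κ ≤ 1)
    (hκU : ∀ η : ℝ, 0 < η → ∀ᶠ X : ℕ in atTop,
      (κ - η) * (heightFamilyBelow X).card ≤ ((heightFamilyBelow X).filter U).card)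
    (hW : ∀ η : ℝ, 0 < η → ∀ᶠ X : ℕ in atTop,
      (((heightFamilyBelow X).filter (fun AB ↦ ¬ W AB)).card : ℝ) ≤ η * (heightFamilyBelow X).card) :
    HeightDensityGE SatisfiesBSDRankLeOne (19 / 24 + κ / 12) := by
  -- (the pieces of `heightDensityGE_satisfiesBSDRankLeOne_of_pieces` carry classical decidability
  -- instances; `Finset.filter_true` / `Finset.filter_false` and `hTS` are stated for any instance)
  have hTS : ∀ (X : ℕ) (inst : DecidablePred (fun _ : ℤ × ℤ ↦ True ∧ ¬ True)),
      (@Finset.filter _ (fun _ : ℤ × ℤ ↦ True ∧ ¬ True) inst (heightFamilyBelow X)).card = 0 :=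
    fun X inst ↦ by simp
  refine heightDensityGE_satisfiesBSDRankLeOne_of_pieces hGZK hDD
    (fun _ ↦ True) (fun _ ↦ True) U (fun _ ↦ False) (fun _ ↦ False) (fun _ ↦ True) W
    (fun _ _ ↦ trivial) (fun _ _ ↦ trivial) (fun _ h ↦ h.elim) (fun _ h ↦ h.elim)
    (fun _ h ↦ h.elim) hU hUflip (fun _ h ↦ h.elim) (fun _ h ↦ h.elim)
    (fun AB hfam _ hWAB h1 ↦ h5all AB hfam hWAB h1)
    (fun AB hfam _ _ hWAB h5 ↦ h9all AB hfam hWAB h5) hWtors ?_ ?_ hκ hκ1 le_rfl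
    (by norm_num : (0 : ℝ) ≤ 1) ?_ ?_ ?_ ?_ ?_ hW (ν := 0) (le_of_eq (by ring))
  · -- Thm 13 on `T` = all curves
    intro η hη
    filter_upwards [h13 η hη] with X hX
    rwa [Finset.filter_true]
  · -- Thm 13 on `U₀ = ∅`
    intro _ _
    exact Eventually.of_forall fun X ↦ by simp
  · -- `μT = 1`
    intro η hη
    refine Eventually.of_forall fun X ↦ ?_
    rw [Finset.filter_true]
    have h0 : (0 : ℝ) ≤ (heightFamilyBelow X).card := Nat.cast_nonneg _
    nlinarith
  · -- `U` has relative density `κ` in `T` = all curves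
    intro η hη
    filter_upwards [hκU η hη] with X hX
    rwa [Finset.filter_true]
  · -- `μR = 0`
    intro η hη
    refine Eventually.of_forall fun X ↦ ?_
    rw [Finset.filter_false, Finset.card_empty, Nat.cast_zero]
    have h0 : (0 : ℝ) ≤ (heightFamilyBelow X).card := Nat.cast_nonneg _
    nlinarith
  · -- `U₀ = ∅` inside `R = ∅`
    intro _ _
    exact Eventually.of_forall fun X ↦ by simp
  · -- `ν = 0`: `T ∖ S₁ = ∅`
    intro η hη
    refine Eventually.of_forall fun X ↦ ?_
    rw [hTS X, Nat.cast_zero]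
    have h0 : (0 : ℝ) ≤ (heightFamilyBelow X).card := Nat.cast_nonneg _
    nlinarith

/-- **At `κ = .5501` (Thm 16) the ceiling is Bhargava–Shankar's `83.75%`.** Under the hypotheses of
`heightDensityGE_satisfiesBSDRankLeOne_ceiling_of_criteria` with `U` of lower density `.5501` —
in particular the HYPOTHETICAL criteria `h5all` / `h9all` for every curve — at least `83.75%` of
elliptic curves over `ℚ` would satisfy the Birch and Swinnerton-Dyer rank conjecture with rank `≤ 1`
(`19/24 + .5501/12 = .837508… ≥ .8375`); compare source §4 ("increases to `79.7%` (working also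
with the prime `3` would push this lower bound over `80%`)") and Bhargava–Shankar's Thm 4.
[cite: BhargavaSkinnerZhang2014, §4 (first paragraph)]
[cite: BhargavaShankar5Selmer2013, Thm 4] -/
theorem heightDensityGE_satisfiesBSDRankLeOne_8375_of_criteria
    (hGZK : rank_eq_analyticRank_of_analyticRank_le_one)
    (hDD : even_selmerRank_sub_torsionRank_iff) (U W : ℤ × ℤ → Prop)
    (hU : ∀ AB, U AB → U (negB AB))
    (hUflip : ∀ AB, U AB →
      (shortWeierstrass (negB AB)).rootNumber = -(shortWeierstrass AB).rootNumber)
    (h5all : ∀ AB, IsInHeightFamily AB → W AB →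
      Nat.card ((shortWeierstrass AB).selmerGroup 5) = 1 →
        (shortWeierstrass AB).mordellWeilRank = 0 ∧ (shortWeierstrass AB).analyticRank = 0)
    (h9all : ∀ AB, IsInHeightFamily AB → W AB →
      Nat.card ((shortWeierstrass AB).selmerGroup 5) = 5 →
        (shortWeierstrass AB).mordellWeilRank = 1 ∧ (shortWeierstrass AB).analyticRank = 1)
    (hWtors : ∀ AB, IsInHeightFamily AB → W AB → (shortWeierstrass AB).toAffine.Point[(5 : ℤ)] = ⊥)
    (h13 : ∀ η : ℝ, 0 < η → ∀ᶠ X : ℕ in atTop,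
      ∑ AB ∈ heightFamilyBelow X, (Nat.card ((shortWeierstrass AB).selmerGroup 5) : ℝ) ≤
        (6 + η) * (heightFamilyBelow X).card)
    (hκU : ∀ η : ℝ, 0 < η → ∀ᶠ X : ℕ in atTop,
      (0.5501 - η) * (heightFamilyBelow X).card ≤ ((heightFamilyBelow X).filter U).card)
    (hW : ∀ η : ℝ, 0 < η → ∀ᶠ X : ℕ in atTop,
      (((heightFamilyBelow X).filter (fun AB ↦ ¬ W AB)).card : ℝ) ≤ η * (heightFamilyBelow X).card) :
    HeightDensityGE SatisfiesBSDRankLeOne 0.8375 := by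
  have h := heightDensityGE_satisfiesBSDRankLeOne_ceiling_of_criteria hGZK hDD U W hU hUflip h5all
    h9all hWtors h13 (by norm_num) (by norm_num) hκU hW
  intro ε hε
  filter_upwards [h ε hε] with X hX
  norm_num at hX ⊢
  linarith

end Ceiling

/-! ### Thm 27 of the source: the BSD rank conjecture for `100%`, granted the inputs at every prime

"Tracing through the methods of the previous sections, with a general value of `p` in place of
`p = 5`, immediately allows us to deduce: **Theorem 27.** Consider the family of all elliptic curves
over `ℚ` ordered by height. Suppose that for all primes `p`, the average size of the `p`-Selmer group
of elliptic curves over `ℚ` is `p+1`. Then the Birch and Swinnerton-Dyer rank conjecture is true for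
`100%` of elliptic curves over `ℚ`. *Proof.* Let `p` be a prime. A lower bound on the density
`μ(S₀(p) ∩ S₁(p))` is `(1-1/p)²·∏_{ℓ ≡ ±1 (mod p)} (1-1/ℓ¹⁰)⁻¹(1-1/ℓ⁵)²`. Of these, by the proof of
Corollary 26, a proportion of at least `(p²-p-1)/(p²-1)` have algebraic and analytic rank `0` or
`1`. As `p` tends to infinity, the product … tends to `1`." (source §4, p. 13).

Below, EVERY per-prime input of this deduction is an explicit binder indexed by the prime `p` (none
of them is a theorem of the tree, and for `p ≥ 7` the Selmer average is the theorem's hypothesis,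
the conjecture of Poonen–Rains): the Selmer average on `T p` (the source's `S₀(p) ∩ S₁(p)`, a finite
union of large families, to which Thm 13-at-`p` applies), the two criteria at `p` on `T p ∩ W p`
(Thms 5 and 9 "with a general value of `p`"; their conditions (a)–(e) are what `S₀(p)`, `S₁(p)` and
`W p` carry), a density-one set `W p` (Lemma 20 at `p`), and `μ(T p) → 1` along the primes. -/

section AllPrimes

/-- **The count behind Thm 27 at a finite height, one prime `p`.** For subfamilies `T`, `W` such
that on `T ∩ W` the criteria hold — `#S_p(E) = 1 ⟹ rank = an.rank = 0` (`hcrit0`, Thm 5 at `p`)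
and `#S_p(E) = p ⟹ rank = an.rank = 1` (`hcrit1`, Thm 9 at `p`) — and granted
Gross–Zagier–Kolyvagin (`hGZK`):
`p²·N_T - Σ_T #S_p ≤ (p² - 1)·(#{E : H(E) < X, SatisfiesBSDRankLeOne} + N_{¬W})`. Proof:
`thm25_count` at `p` ("`x + p²(1 - x) ≤ p + 1`") bounds the left side by `(p²-1)·#{E ∈ T : #S_p ≤ p}`,
and `#S_p ≤ p` means `#S_p ∈ {1, p}` (`natCard_selmerGroup_le_iff`), whence BSD with rank `≤ 1` on
`W` by the criteria and GZK (`satisfiesBSDRankLeOne_of_rank_eq`), or membership in `¬W`.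
[cite: BhargavaSkinnerZhang2014, Thm 27 (proof) with Thm 25 (first part, proof) and Cor 26 (proof)] -/
theorem thm27_count (hGZK : rank_eq_analyticRank_of_analyticRank_le_one) (p : ℕ) [Fact p.Prime]
    (T W : ℤ × ℤ → Prop)
    (hcrit0 : ∀ AB, IsInHeightFamily AB → T AB → W AB →
      Nat.card ((shortWeierstrass AB).selmerGroup p) = 1 →
        (shortWeierstrass AB).mordellWeilRank = 0 ∧ (shortWeierstrass AB).analyticRank = 0)
    (hcrit1 : ∀ AB, IsInHeightFamily AB → T AB → W AB →
      Nat.card ((shortWeierstrass AB).selmerGroup p) = p →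
        (shortWeierstrass AB).mordellWeilRank = 1 ∧ (shortWeierstrass AB).analyticRank = 1)
    (X : ℕ) :
    (p : ℝ) ^ 2 * ((heightFamilyBelow X).filter T).card -
        ∑ AB ∈ (heightFamilyBelow X).filter T,
          (Nat.card ((shortWeierstrass AB).selmerGroup p) : ℝ) ≤
      ((p : ℝ) ^ 2 - 1) * ((((heightFamilyBelow X).filter SatisfiesBSDRankLeOne).card : ℝ) +
        ((heightFamilyBelow X).filter (fun AB ↦ ¬ W AB)).card) := by
  have h25 := thm25_count p T X
  -- `{E ∈ T : #S_p ≤ p} ⊆ {BSD, rank ≤ 1} ∪ {¬ W}`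
  have hsub : ((heightFamilyBelow X).filter T).filter
        (fun AB ↦ Nat.card ((shortWeierstrass AB).selmerGroup p) ≤ p) ⊆
      (heightFamilyBelow X).filter SatisfiesBSDRankLeOne ∪
        (heightFamilyBelow X).filter (fun AB ↦ ¬ W AB) := by
    intro AB h
    simp only [Finset.mem_filter, Finset.mem_union] at h ⊢
    obtain ⟨⟨hX, hT⟩, hle⟩ := h
    by_cases hW : W AB
    · left
      have hfam : IsInHeightFamily AB := ((mem_heightFamilyBelow_iff AB X).mp hX).1
      haveI := isElliptic_shortWeierstrass hfam
      refine ⟨hX, ?_⟩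
      rcases (natCard_selmerGroup_le_iff (shortWeierstrass AB) p).mp hle with h1 | hp'
      · exact satisfiesBSDRankLeOne_of_rank_eq hGZK hfam zero_le_one (hcrit0 AB hfam hT hW h1)
      · exact satisfiesBSDRankLeOne_of_rank_eq hGZK hfam le_rfl (hcrit1 AB hfam hT hW hp')
    · right
      exact ⟨hX, hW⟩
  have hcard : ((((heightFamilyBelow X).filter T).filter
        (fun AB ↦ Nat.card ((shortWeierstrass AB).selmerGroup p) ≤ p)).card : ℝ) ≤
      (((heightFamilyBelow X).filter SatisfiesBSDRankLeOne).card : ℝ) +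
        ((heightFamilyBelow X).filter (fun AB ↦ ¬ W AB)).card := by
    exact_mod_cast (Finset.card_le_card hsub).trans (Finset.card_union_le _ _)
  have hp : p.Prime := Fact.out
  have hp2 : (2 : ℝ) ≤ p := by exact_mod_cast hp.two_le
  have hD : (0 : ℝ) ≤ (p : ℝ) ^ 2 - 1 := by nlinarith
  have hmul := mul_le_mul_of_nonneg_left hcard hD
  linarith

/-- **Thm 27 of the source**, with its per-prime inputs as binders. Data: for every prime `p`,
subfamilies `T p` (the source's `S₀(p) ∩ S₁(p)`) and `W p` (the `100%` conditions of Lemma 20 at `p`).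
Hypotheses: (`h13`) for every prime `p` the `p`-Selmer groups of the members of `T p` of height `< X`
sum to `≤ (p + 1 + η)·N_{T p}` eventually, for every `η > 0` — "for all primes `p`, the average size of
the `p`-Selmer group … is `p+1`", applied to `T p` as Thm 13 is in the proof of Cor 26; (`hcrit0`,
`hcrit1`) the criteria of Thms 5 and 9 at `p` on `T p ∩ W p`; (`hW`) `W p` has density one, as a count
of exceptions; (`hT`) for every `δ > 0`, all sufficiently large primes `p` have `μ(T p) ≥ 1 - δ`
("as `p` tends to infinity, the product … tends to `1`"); and Gross–Zagier–Kolyvagin (`hGZK`).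
Conclusion: **`100%` of elliptic curves over `ℚ`, ordered by naive height, satisfy
`SatisfiesBSDRankLeOne`** (`rank = an.rank ≤ 1` and `Ш` finite; lower density `1`). Proof: for
`ε > 0` pick a prime `p` with `4(p + 1) ≤ ε(p² - 1)` and `μ(T p) ≥ 1 - ε/4`
(`Nat.exists_infinite_primes`); at height `X`, `thm27_count` with `Σ_{T p} ≤ (p + 3/2) N_{T p}`,
`N_{T p} ≥ (1 - 3ε/8) N`, `N_{¬W p} ≤ (ε/8) N` gives `#{BSD, rank ≤ 1} ≥ (1 - ε) N`. The rank-only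
core is `heightDensityGE_rankLeOne_one_of_forall_prime` (`BSDRankLeOneDensitySelmerAverage.lean`).
[cite: BhargavaSkinnerZhang2014, Thm 27 and its proof (§4)] -/
theorem heightDensityGE_satisfiesBSDRankLeOne_one_of_forall_prime
    (hGZK : rank_eq_analyticRank_of_analyticRank_le_one) (T W : ℕ → ℤ × ℤ → Prop)
    (h13 : ∀ p : ℕ, p.Prime → ∀ η : ℝ, 0 < η → ∀ᶠ X : ℕ in atTop,
      ∑ AB ∈ (heightFamilyBelow X).filter (T p),
          (Nat.card ((shortWeierstrass AB).selmerGroup p) : ℝ) ≤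
        ((p : ℝ) + 1 + η) * ((heightFamilyBelow X).filter (T p)).card)
    (hcrit0 : ∀ p : ℕ, p.Prime → ∀ AB, IsInHeightFamily AB → T p AB → W p AB →
      Nat.card ((shortWeierstrass AB).selmerGroup p) = 1 →
        (shortWeierstrass AB).mordellWeilRank = 0 ∧ (shortWeierstrass AB).analyticRank = 0)
    (hcrit1 : ∀ p : ℕ, p.Prime → ∀ AB, IsInHeightFamily AB → T p AB → W p AB →
      Nat.card ((shortWeierstrass AB).selmerGroup p) = p →
        (shortWeierstrass AB).mordellWeilRank = 1 ∧ (shortWeierstrass AB).analyticRank = 1)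
    (hW : ∀ p : ℕ, p.Prime → ∀ η : ℝ, 0 < η → ∀ᶠ X : ℕ in atTop,
      (((heightFamilyBelow X).filter (fun AB ↦ ¬ W p AB)).card : ℝ) ≤ η * (heightFamilyBelow X).card)
    (hT : ∀ δ : ℝ, 0 < δ → ∀ᶠ p : ℕ in atTop, p.Prime → HeightDensityGE (T p) (1 - δ)) :
    HeightDensityGE SatisfiesBSDRankLeOne 1 := by
  intro ε hε
  -- the statement is empty for `ε ≥ 1`
  by_cases hε1 : 1 ≤ ε
  · refine Eventually.of_forall fun X ↦ ?_
    rw [heightProportion_eq_card_div]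
    exact le_trans (b := 0) (by linarith) (by positivity)
  push Not at hε1
  -- a prime `p` with `μ(T p) ≥ 1 - ε/4` and `4 (p + 1) ≤ ε (p² - 1)`
  obtain ⟨N₀, hN₀⟩ := eventually_atTop.mp (hT (ε / 4) (by positivity))
  obtain ⟨n, hn⟩ := exists_nat_gt (4 / ε + 1)
  obtain ⟨p, hpge, hp⟩ := Nat.exists_infinite_primes (max (n + 2) N₀)
  haveI : Fact p.Prime := ⟨hp⟩
  have hpn : n + 2 ≤ p := le_trans (le_max_left _ _) hpge
  have hpN₀ : N₀ ≤ p := le_trans (le_max_right _ _) hpge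
  have hp2 : (2 : ℝ) ≤ p := by exact_mod_cast hp.two_le
  have hpnR : (n : ℝ) + 2 ≤ p := by exact_mod_cast hpn
  have hDpos : (0 : ℝ) < (p : ℝ) ^ 2 - 1 := by nlinarith
  -- `4 ≤ ε (p - 1)`, hence `4 (p + 1) ≤ ε (p² - 1)`
  have hεp : 4 ≤ ε * ((p : ℝ) - 1) := by
    have h1 : 4 / ε < (p : ℝ) - 1 := by linarith
    have h2 := (div_lt_iff₀ hε).mp h1
    linarith
  have hεD : 4 * ((p : ℝ) + 1) ≤ ε * ((p : ℝ) ^ 2 - 1) := by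
    have h0 : (0 : ℝ) ≤ (p : ℝ) + 1 := by linarith
    nlinarith [mul_le_mul_of_nonneg_right hεp h0]
  -- the three counts at height `X`
  have hTp : HeightDensityGE (T p) (1 - ε / 4) := hN₀ p hpN₀ hp
  have e1 := hTp.eventually_mul_card_le (ε / 8) (by positivity)
  have e2 := hW p hp (ε / 8) (by positivity)
  have e3 := h13 p hp (1 / 2) (by norm_num)
  filter_upwards [e1, e2, e3, eventually_heightFamilyBelow_card_pos] with X hX1 hX2 hX3 hpos
  have hN : (0 : ℝ) < (heightFamilyBelow X).card := by exact_mod_cast hpos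
  rw [heightProportion_eq_card_div, le_div_iff₀ hN]
  have hcount := thm27_count hGZK p (T p) (W p) (hcrit0 p hp) (hcrit1 p hp) X
  -- abbreviations
  set N : ℝ := ((heightFamilyBelow X).card : ℝ) with hNdef
  set NT : ℝ := (((heightFamilyBelow X).filter (T p)).card : ℝ)
  set NW : ℝ := (((heightFamilyBelow X).filter (fun AB ↦ ¬ W p AB)).card : ℝ)
  set B : ℝ := (((heightFamilyBelow X).filter SatisfiesBSDRankLeOne).card : ℝ)
  set ST : ℝ := ∑ AB ∈ (heightFamilyBelow X).filter (T p),
    (Nat.card ((shortWeierstrass AB).selmerGroup p) : ℝ)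
  set D : ℝ := (p : ℝ) ^ 2 - 1 with hDdef
  -- `D·B ≥ c·N_T - D·N_{¬W}` with `c = D - p - 1/2 ≥ 0`
  have hc : (0 : ℝ) ≤ D - p - 1 / 2 := by rw [hDdef]; nlinarith
  have ha : (D - p - 1 / 2) * NT - D * NW ≤ D * B := by
    have : (p : ℝ) ^ 2 * NT - ST = (D - p - 1 / 2) * NT + (((p : ℝ) + 1 + 1 / 2) * NT - ST) := by
      rw [hDdef]; ring
    nlinarith [hcount, hX3, this]
  have hb : (D - p - 1 / 2) * ((1 - ε / 4 - ε / 8) * N) ≤ (D - p - 1 / 2) * NT :=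
    mul_le_mul_of_nonneg_left hX1 hc
  have hcW : D * NW ≤ D * (ε / 8 * N) := mul_le_mul_of_nonneg_left hX2 hDpos.le
  -- the scalar inequality `D (1 - ε) ≤ c (1 - 3ε/8) - D ε/8`, from `4 (p + 1) ≤ ε D`
  have hscalar : D * (1 - ε) ≤ (D - p - 1 / 2) * (1 - ε / 4 - ε / 8) - D * (ε / 8) := by
    rw [hDdef] at hεD ⊢
    have hεp0 : (0 : ℝ) ≤ ε * p := by positivity
    nlinarith [hεD, hεp0, hε, hε1, hp2]
  have hscalarN := mul_le_mul_of_nonneg_right hscalar hN.le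
  have hfinal : D * ((1 - ε) * N) ≤ D * B := by nlinarith [ha, hb, hcW, hscalarN]
  exact le_of_mul_le_mul_left hfinal hDpos

end AllPrimes

end Literature.NumberTheory.EllipticCurves

end
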